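import Summits.CriticalPhenomena.PercolationContinuityZ3.Theorems.PercNearOneGluingNoHeavyLowerTailIncStarC5Schema
import Summits.CriticalPhenomena.PercolationContinuityZ3.Theorems.PercNearOneGluingNoHeavyLowerTailIncStarC5RootTargetStep
import Summits.CriticalPhenomena.PercolationContinuityZ3.Theorems.PercNearOneGluingNoHeavyLowerTailIncStarC5TargetTargetStepTcy
import Summits.CriticalPhenomena.PercolationContinuityZ3.Theorems.PercNearOneGluingNoHeavyLowerTailIncStarC5TargetTargetStepTyc
import HarnessLib

/-!
# The increasing star from the a–UNMARKED step alone (Sahi programme, prover prim-sahi-p2 gen 40)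

Support file (`--supports stmt-CriticalPhenomena-4575`, helper).  No definitions, no named facts, no sorries; standard axioms.
Memo `run/shared/lean/prim/prim-sahi/FROM-prim-sahi-p2-gen40-C5-LIGHT-INDUCTION.md` §3, `prim-sahi-p2/PROOF-E3.md` §50.

The schema `IncStar.c5_nonneg_of_targetPairStep` (…IncStarC5Schema) reduces the C5 family — hence the increasing star `E₃({s↔a},{s↔b},{s↔c}) ≥ 0`
and ISTAR⁺ — to ONE Bernstein step along a fractional pair `s(a,z)` at the distinguished target `a`, for every `z`.  Here the cases `z = s` (root),
`z = b` and `z = c` (the other targets) are DISCHARGED by the Harris-light certificates landed by this seat (`IncStar.c5_rootTarget_tcy_polar_nonneg`,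
`IncStar.c5_targetTarget_tyc_polar_nonneg`, `IncStar.c5_targetTarget_tcy_polar_nonneg`, with `IncStar.c5_nonneg_of_bernstein`), so that what remains is
exactly the a–UNMARKED step (`z ∉ {s,b,c}`; DARK at degree 3 in the 52-cell algebra, memo §3):

* **`c5_nonneg_of_targetUnmarkedStep`** — if for every weight, every marking and every fractional pair `s(a,z)` with `z ∉ {a,s,b,c}` the form
  `C5(P_w; s; a; b, c)` is nonnegative GRANTED the C5 family for fewer fractional pairs, then `C5 ≥ 0` on every finite weighted graph;
* **`incStar_of_targetUnmarkedStep`** — hence the increasing star on every finite weighted graph; `incStarPlus_of_targetUnmarkedStep` — and ISTAR⁺.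

Nothing here asserts the a–unmarked step.
-/

noncomputable section

namespace Summit.CriticalPhenomena.PercolationContinuityZ3.Theorems

namespace IncStar

open MeasureTheory Set Literature.Probability.Percolation Literature.Probability.LatticeModels EdgeInduction
open scoped Classical

variable {n : ℕ}

/-- **The C5 family from the a–unmarked step.**  See the module docstring. [this work] -/
theorem c5_nonneg_of_targetUnmarkedStep
    (hTU : ∀ (v : Sym2 (Fin n) → unitInterval) (s a z b c : Fin n), a ≠ z → z ≠ s → z ≠ b → z ≠ c → s(a, z) ∈ fracEdges v →
      (∀ v' : Sym2 (Fin n) → unitInterval, (fracEdges v').card < (fracEdges v).card → ∀ s' a' b' c' : Fin n,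
          let μ := prodBernoulli v'
          0 ≤ 2 * μ.real (openConn s' a' ∩ openConn s' b' ∩ openConn s' c') + μ.real (openConn s' a') * μ.real (openConn s' b') * μ.real (openConn s' c')
                - μ.real (openConn s' a') * μ.real (openConn s' b' ∩ openConn s' c') - 2 * (μ.real (openConn s' b') * μ.real (openConn s' a' ∩ openConn s' c'))) →
      let μ := prodBernoulli v
      0 ≤ 2 * μ.real (openConn s a ∩ openConn s b ∩ openConn s c) + μ.real (openConn s a) * μ.real (openConn s b) * μ.real (openConn s c)
            - μ.real (openConn s a) * μ.real (openConn s b ∩ openConn s c) - 2 * (μ.real (openConn s b) * μ.real (openConn s a ∩ openConn s c))) :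
    ∀ (w : Sym2 (Fin n) → unitInterval) (s a b c : Fin n),
      let μ := prodBernoulli w
      0 ≤ 2 * μ.real (openConn s a ∩ openConn s b ∩ openConn s c) + μ.real (openConn s a) * μ.real (openConn s b) * μ.real (openConn s c)
            - μ.real (openConn s a) * μ.real (openConn s b ∩ openConn s c) - 2 * (μ.real (openConn s b) * μ.real (openConn s a ∩ openConn s c)) := by
  refine c5_nonneg_of_targetPairStep ?_
  intro v s a z b c haz hg IH
  -- the two extreme coefficients along `s(a,z)` are instances of the induction hypothesis
  have h0 := IH (Function.update v s(a, z) 0) (card_fracEdges_update_lt' v hg 0 (Or.inl rfl)) s a b c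
  have h3 := IH (Function.update v s(a, z) 1) (card_fracEdges_update_lt' v hg 1 (Or.inr rfl)) s a b c
  simp only at h0 h3 ⊢
  by_cases hzs : z = s
  · -- ROOT–a pair: `IncStar.c5_rootTarget_tcy_polar_nonneg` (the level-1 instance it needs is Harris for the two lifted unions)
    subst hzs
    have hsw : s(a, z) = s(z, a) := Sym2.eq_swap
    rw [hsw] at h0 h3
    have hza : z ≠ a := fun h => haz h.symm
    have key := c5_rootTarget_tcy_polar_nonneg v z a b c hza h0 (by
      have hH := prodBernoulli_harris (Function.update v s(z, a) 0)
        ((isUpperSet_openConn (V := Fin n) z b).union (isUpperSet_openConn (V := Fin n) a b))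
        ((isUpperSet_openConn (V := Fin n) z c).union (isUpperSet_openConn (V := Fin n) a c)) MeasurableSet.of_discrete MeasurableSet.of_discrete
      rw [probReal_univ]
      nlinarith [hH])
    exact c5_nonneg_of_bernstein v s(z, a) (openConn z a) (openConn z b) (openConn z c) h0 key.1 key.2 h3
  by_cases hzb : z = b
  · -- a–b pair: `IncStar.c5_targetTarget_tyc_polar_nonneg` with `(t, c, y) := (a, c, b)`; its second hypothesis is the level-0 instance `C5(c; b, a)`
    subst hzb
    have h0' := IH (Function.update v s(a, z) 0) (card_fracEdges_update_lt' v hg 0 (Or.inl rfl)) s c z a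
    simp only at h0'
    have key := c5_targetTarget_tyc_polar_nonneg v s a c z h0 h0'
    exact c5_nonneg_of_bernstein v s(a, z) (openConn s a) (openConn s z) (openConn s c) h0 key.1 key.2 h3
  by_cases hzc : z = c
  · -- a–c pair: `IncStar.c5_targetTarget_tcy_polar_nonneg` with `(t, c, y) := (a, b, c)`; its second hypothesis is the LIFTED level-1 instance `C5(a; b, c)`
    subst hzc
    have L : ∀ S : Set (BondConfig (Fin n)), (prodBernoulli (Function.update v s(a, z) 1)).real S =
        (prodBernoulli (Function.update v s(a, z) 0)).real ((fun ω : BondConfig (Fin n) => insert s(a, z) ω) ⁻¹' S) := tieLiftOne_real_one_eq v s(a, z)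
    have pF := preimage_insertTT_left s a z
    have pH := preimage_insertTT_right s a z
    have pG := preimage_insertTT_third s a z b
    have h3' := h3
    simp only [L, Set.preimage_inter, pF, pG, pH] at h3'
    have key := c5_targetTarget_tcy_polar_nonneg v s a b z h0 h3'
    exact c5_nonneg_of_bernstein v s(a, z) (openConn s a) (openConn s b) (openConn s z) h0 key.1 key.2 h3
  · exact hTU v s a z b c haz hzs hzb hzc hg IH

/-- **THE INCREASING STAR FROM THE a–UNMARKED STEP.**  If the Bernstein step for `C5(P; s; a; b, c)` holds along every fractional pair `s(a,z)` with
`z ∉ {a, s, b, c}` (granted the C5 family for fewer fractional pairs), then `E₃({s↔a},{s↔b},{s↔c}) ≥ 0` on every finite weighted graph. [this work] -/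
theorem incStar_of_targetUnmarkedStep
    (hTU : ∀ (v : Sym2 (Fin n) → unitInterval) (s a z b c : Fin n), a ≠ z → z ≠ s → z ≠ b → z ≠ c → s(a, z) ∈ fracEdges v →
      (∀ v' : Sym2 (Fin n) → unitInterval, (fracEdges v').card < (fracEdges v).card → ∀ s' a' b' c' : Fin n,
          let μ := prodBernoulli v'
          0 ≤ 2 * μ.real (openConn s' a' ∩ openConn s' b' ∩ openConn s' c') + μ.real (openConn s' a') * μ.real (openConn s' b') * μ.real (openConn s' c')
                - μ.real (openConn s' a') * μ.real (openConn s' b' ∩ openConn s' c') - 2 * (μ.real (openConn s' b') * μ.real (openConn s' a' ∩ openConn s' c'))) →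
      let μ := prodBernoulli v
      0 ≤ 2 * μ.real (openConn s a ∩ openConn s b ∩ openConn s c) + μ.real (openConn s a) * μ.real (openConn s b) * μ.real (openConn s c)
            - μ.real (openConn s a) * μ.real (openConn s b ∩ openConn s c) - 2 * (μ.real (openConn s b) * μ.real (openConn s a ∩ openConn s c)))
    (w : Sym2 (Fin n) → unitInterval) (s a b c : Fin n) :
    0 ≤ sahiE3 (prodBernoulli w) (openConn s a) (openConn s b) (openConn s c) :=
  sahiE3_nonneg_of_c5 _ _ _ _ (c5_nonneg_of_targetUnmarkedStep hTU w s a b c) (c5_nonneg_of_targetUnmarkedStep hTU w s a c b)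

/-- **ISTAR⁺ from the a–unmarked step**: `E₃ ≥ |P(B)P(A∩C) − P(C)P(A∩B)|` for the star events, under the same hypothesis. [this work] -/
theorem incStarPlus_of_targetUnmarkedStep
    (hTU : ∀ (v : Sym2 (Fin n) → unitInterval) (s a z b c : Fin n), a ≠ z → z ≠ s → z ≠ b → z ≠ c → s(a, z) ∈ fracEdges v →
      (∀ v' : Sym2 (Fin n) → unitInterval, (fracEdges v').card < (fracEdges v).card → ∀ s' a' b' c' : Fin n,
          let μ := prodBernoulli v'
          0 ≤ 2 * μ.real (openConn s' a' ∩ openConn s' b' ∩ openConn s' c') + μ.real (openConn s' a') * μ.real (openConn s' b') * μ.real (openConn s' c')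
                - μ.real (openConn s' a') * μ.real (openConn s' b' ∩ openConn s' c') - 2 * (μ.real (openConn s' b') * μ.real (openConn s' a' ∩ openConn s' c'))) →
      let μ := prodBernoulli v
      0 ≤ 2 * μ.real (openConn s a ∩ openConn s b ∩ openConn s c) + μ.real (openConn s a) * μ.real (openConn s b) * μ.real (openConn s c)
            - μ.real (openConn s a) * μ.real (openConn s b ∩ openConn s c) - 2 * (μ.real (openConn s b) * μ.real (openConn s a ∩ openConn s c)))
    (w : Sym2 (Fin n) → unitInterval) (s a b c : Fin n) :
    |(prodBernoulli w).real (openConn s b) * (prodBernoulli w).real (openConn s a ∩ openConn s c)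
        - (prodBernoulli w).real (openConn s c) * (prodBernoulli w).real (openConn s a ∩ openConn s b)|
      ≤ sahiE3 (prodBernoulli w) (openConn s a) (openConn s b) (openConn s c) :=
  abs_le_sahiE3_of_c5 _ _ _ _ (c5_nonneg_of_targetUnmarkedStep hTU w s a b c) (c5_nonneg_of_targetUnmarkedStep hTU w s a c b)

end IncStar

end Summit.CriticalPhenomena.PercolationContinuityZ3.Theorems
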